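import Mathlib
import Literature.MathematicalPhysics.QuantumFieldTheory.MagnenRivasseauSeneor1993.MRS93AxialWardIdentity
import HarnessLib

/-!
# Magnen–Rivasseau–Sénéor (CMP 155, 1993), Sect. IV display (IV.2) p.353 AS PRINTED: «the action is not exactly
# invariant [under the truncated transformation A′ ≡ A^{γ,2}], but the difference is a complicated polynomial with at
# least two powers of λ» — the difference `M(A, γ)` made explicit on pointwise jets and its «O(λ²)» KERNEL-CHECKED,
# with the contrast that the first-order transformation `A^γ = A^{γ,1}` of (II.5) leaves a difference of order `λ¹`;
# (v1.1) the same defect expanded in `γ`: no term linear in `γ` either («no first order dependence in γ», (VIII.2))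

statement-level skeleton of a published definition/display with citation tags; the algebra proved; nothing here is a
claim about the Yang–Mills mass gap, about continuum Yang–Mills on `T⁴` without infrared cutoff, or about the Clay
problem — and nothing of Magnen–Rivasseau–Sénéor's expansion or estimates is asserted or formalised

**Citation header (reproduction of PUBLISHED work).** J. Magnen, V. Rivasseau, R. Sénéor, *Construction of YM₄ with
an infrared cutoff*, Commun. Math. Phys. **155** (1993) 325–383 [MagnenRivasseauSeneor1993], Sect. IV p.353 tl.2–5
with the display (IV.2); Sect. II.A (II.3)–(II.6) p.329 tl.2–19, (II.9)–(II.10) p.330 tl.6–10, (II.32b)–(II.32c) p.338 tl.42–46 and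
p.339 tl.2–3; Sect. II.E p.342 tl.5–7; Sect. IV p.352 tl.26–27. Loci `p.NNN tl.nn` = journal page / text-layer line of the held scan
`paper:magnen1993-cmp155-mrs-ym4-infrared-cutoff` (PDF page = journal page − 324); (IV.2) re-read on the decoded
600 dpi page image (renders of record `run/shared/lean/pub/lit-balaban/inprint/lit-balaban-p14/renders-cmp155/
p29_full_s6.png`; 2× crop `run/shared/lean/pub/pub-balaban-gaps/pub-balaban-gaps-mrs-lit-1/g10/renders/
p29_crop_r350-1150_s2.png` — the text layer renders the display as «M(Λ 7), M(A, 7)»; the image prints `M(A, γ)`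
twice). Cell pub-balaban-gaps (YM blitz, track G3 «MRS 1993 typed AS PRINTED as the independent second ultraviolet
route»), seat mrs-lit-1 (gen 10); companion prose `run/shared/lean/pub/pub-balaban-gaps/g3/MRS-AS-PRINTED.md` §2, §5;
the companion seat's display concordance (`g3/MRS-AS-PRINTED-estimates.md` §7) lists (IV.2) as not covered by any of
the 44 `MRS93*.lean` files before this one. Builds, BY NAME and without re-declaring anything, on
`…MRS93InfinitesimalGauge` (seat mrs-lit-1 gen 5: the jets `GaugeJet`, (II.5) `covD`/`gaugeInf`, (II.6) `gaugeTrunc2`,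
(II.32c) `rotTrunc`, `fieldStrengthSq = Σ_{μνa}(F^a_μν)²`, `curvature_gaugeLine`, `fieldStrengthSq_gaugeInf`,
`gaugeRemainder`, `gaugeTrunc2_add`), on `…MRS93CurvatureDecomposition` (seat mrs-lit-2: `SectIV.FieldJet`, (II.1)
`SectIV.curvature`), on `…MRS93TruncatedGauge` (the printed su(2) bracket `bracket` = the cross product on `ℝ³`, `eps`)
and on `…MRS93AxialWardIdentity` (gen 7: `IsAxialJet`, `S0`, `fieldStrengthSq_eq_S0` = the split (II.9) at a point).

**What the paper prints (verbatim, from the page images).**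
* p.353 tl.2–5 with (IV.2): *«The Yang-Mills action is invariant under exact gauge transformations. However if we use
  truncated transformations, i.e. such as A′ ≡ A^{γ,2} the action is not exactly invariant, but the difference is a
  complicated polynomial with at least two powers of λ:*
  *F²_sp(A) + ⟨A, p₀²A⟩ = F²(A′) + M(A, γ),   M(A, γ) = O(λ²).   (IV.2)»*
* p.329 tl.2–5: *«F² = F₂ + λF₃ + λ²F₄. (II.3) This action is invariant under the gauge transformations: A → A^g;
  (A^g)_μ = gA_μg⁻¹ + (1/λ)∂_μg · g⁻¹. (II.4)»*; tl.9–11: *«A → A^γ; (A^γ)_μ = A_μ + D_μγ, (II.5) where D = ∂ − λ[A, ·]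
  is the covariant derivative.»*; tl.11–19: *«Finally for technical reasons it is also useful to introduce
  infinitesimal gauge transformations which correspond to expanding to a finite order in γ the exponential in (II.4).
  For instance we are interested in the regime where A ≅ λ^{−1/2−ε₁} and γ ≅ λ^{−1/2−ε₂}, where ε₁ and ε₂ are very
  small and we want to keep all terms not small as λ → 0. Then we should define A^{γ,2}_μ = A_μ + D_μγ + λ/2[γ, ∂_μγ].
  (II.6) This "truncated" gauge transformed configuration A^{γ,2} is a polynomial of second order in γ and its
  derivatives. We could define further expansions of the gauge transformations; with these notations, if g = e^{λγ},
  we have A^g = A^{γ,∞} and A^γ = A^{γ,1}.»*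
* p.330 tl.6–10: *«Indeed in the axial gauge we have F² = ⟨Ap₀²A⟩ + F²_sp, (II.9) where the spatial part of F² is by
  definition F_sp ≡ −(1/2)∫_Λ d⁴x Tr F_mn F^mn = (1/4)∫_Λ d⁴x Σ_a F^a_mn F^{mn,a}, (II.10) and both pieces in (II.9)
  are obviously positive.»*
* p.338 tl.42–46 and p.339 tl.2–3: *«This is also true for the truncated versions of the gauge transformations
  introduced above: (A + B)^{γ,n} = A^{γ,n} + B^{rot γ,n}, (II.32b) where the index n means that the gauge
  transformation for A and the rotation for B are truncated at order n. The term B^{rot γ} is the linear part in B of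
  the gauge transformation B^γ. For example B^{rot γ,2} = B − λ[B, γ]. (II.32c)»*; p.342 tl.5–7: *«Our initial axial
  field A has only nine scalar components since A₀ was identically 0. We want that the special-gauge field A′ contains
  the usual twelve components. In fact one should have A′₀ = ∂₀^{γ,2} = ∂₀γ + (λ/2)[γ, ∂₀γ].»*
* p.352 tl.26–27 (Sect. IV, after (IV.1)): *«This starting point is clearly well defined because we have both finite
  volume and ultraviolet cutoff on each of the fields involved. Hence the sample fields are smooth.»*

**What is typed here (definitions with bodies; the algebra kernel-checked; zero `sorry`, zero named facts).** All
statements are POINTWISE identities between polynomials in the values at one point of `A_μ, ∂_μA_ν, γ, ∂_μγ,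
∂_μ∂_νγ` (READING (J) of `…MRS93InfinitesimalGauge`, `…MRS93AxialWardIdentity`); «F²» at the point is
`InfinitesimalGauge.fieldStrengthSq λ J = Σ_{μ,ν,a}(F^a_μν)²` (four times the integrand of (II.2)/(II.10)), so that the
printed left side «F²_sp(A) + ⟨A, p₀²A⟩» of (IV.2) is, for an axial jet, `AxialWard.S0 λ A = 2Σ_m|∂₀A_m|² +
Σ_{m,n}|F_mn(A)|²` (the split (II.9) at the point, `AxialWard.fieldStrengthSq_eq_S0`; the time pairs `(0,m),(m,0)` of
`Σ_{μν}` give `2Σ_m|∂₀A_m|²`, the density of «⟨A, p₀²A⟩» in the normalisation in which «F²_sp» is `Σ_{mn a}(F^a_mn)²`).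
* §1 **The curvature of `A′ = A^{γ,2}` EXACTLY.** `xTerm A γ ν = X_ν := −[A_ν, γ] + ½[γ, ∂_νγ]`, so that (II.6) reads
  `A^{γ,2}_ν = A_ν + ∂_νγ + λX_ν` (`gaugeTrunc2_val_eq`); `qTerm λ A γ μ ν = Q_μν := −[[A_μ, A_ν], γ] − [A_μ, X_ν] +
  [A_ν, X_μ] − [∂_μγ, X_ν] − [X_μ, ∂_νγ] − λ[X_μ, X_ν]`; **`curvature_gaugeTrunc2`**: for `γ` with symmetric second
  derivatives, `F_μν(A^{γ,2}) = F_μν(A) − λ[F_μν(A), γ] + λ²Q_μν` for every `λ, μ, ν` — the order-`λ` part of the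
  change is the infinitesimal ROTATION `−λ[F, γ]` alone: the curl `λ[∂_μγ, ∂_νγ]` of (II.6)'s second-order term
  `(λ/2)[γ, ∂γ]` cancels the order-`λ` part `−λ[∂_μγ, ∂_νγ]` of the commutator term `−λ[D_μγ, D_νγ]` that the
  first-order transformation leaves (compare `InfinitesimalGauge.curvature_gaugeInf`: `F(A^γ) = F − λ[F, γ] −
  λ[D_μγ, D_νγ]`); `curvature_gaugeTrunc2_zero_coupling` (`λ = 0`: abelian, exactly invariant).
* §2 **(IV.2).** `pairTerm` (per pair `(μ,ν)`: `|[F_μν, γ]|² + 2F_μν·Q_μν − 2λ[F_μν, γ]·Q_μν + λ²|Q_μν|²`), `M2 λ A γ :=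
  −Σ_{μν} pairTerm`, **`defectM λ A γ := Σ(F(A))² − Σ(F(A^{γ,2}))²`** = the printed `M(A, γ)` as a density (in the
  `A`-variables, as the image prints it); **`fieldStrengthSq_gaugeTrunc2`** (`Σ(F(A^{γ,2}))² = Σ(F(A))² − λ²·M₂`, via
  `Σ_a F^a[F, γ]^a = 0`, `InfinitesimalGauge.dot_curvature_bracket_self`); **`eqIV2`** (the first equation of (IV.2):
  `Σ(F(A))² = Σ(F(A′))² + M(A, γ)`, by definition of `M`); **`defectM_eq`** (**«with at least two powers of λ»**:
  `M(A, γ) = λ²·M₂(λ, A, γ)` with `M₂` the explicit polynomial above); `defectM_zero_coupling`; `continuous_M2`;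
  **`defectM_isBigO`** (**«M(A, γ) = O(λ²)»** literally, in Mathlib's asymptotics: `(λ ↦ M) =O[𝓝 0] (λ ↦ λ²)` at
  fixed jets — the printed regime is «as λ → 0», p.329 tl.15).
* §3 **The axial left side and the sum field.** `gaugeTrunc2_val_time` (for an axial jet `A₀ = 0`: `(A^{γ,2})₀ = ∂₀γ +
  (λ/2)[γ, ∂₀γ]` — p.342 tl.5 «A′₀ = ∂₀^{γ,2} = ∂₀γ + (λ/2)[γ, ∂₀γ]» on jets; the momentum-space form on the zero field
  is `MainStatement.dTrunc2Coeff_eq` of `…MRS93TimeComponentPeaking`); **`eqIV2_axial`** ((IV.2) with its printed left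
  side: for an axial jet, `S₀(A) = Σ(F(A^{γ,2}))² + M(A, γ)`); `gaugeTrunc2_sum` and **`eqIV2_add`** ((IV.2) for the
  decomposed field `A = A_s + B_l` of Sect. II.C/IV with `A′ = A_s^{γ,2} + B_l^{rot γ,2} = (A_s + B_l)^{γ,2}` by
  (II.32b), `InfinitesimalGauge.gaugeTrunc2_add` — the variables `(A′_s, B′_l)` of (IV.4)).
* §4 **CONTRAST — the first-order transformation (II.5) leaves ONE power of `λ`** (as-printed precision supporting
  p.329 tl.13–16 «we want to keep all terms not small as λ → 0. Then we should define A^{γ,2} …»; kernel-exhibited,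
  nothing adjudicated): `defect1 λ A γ := Σ(F(A))² − Σ(F(A^γ))²`; `g1`, **`defect1_eq`** (`defect1 = λ·g₁(λ)`, from gen
  5's `fieldStrengthSq_gaugeInf`/`gaugeRemainder`), `c1 A γ := 2Σ_{μνa}(∂_μA_ν − ∂_νA_μ)^a[∂_μγ, ∂_νγ]^a`, `g1_zero`
  (`g₁(0) = c₁`), `continuous_g1`, **`hasDerivAt_defect1`** (`d/dλ|_{λ=0} defect1 = c₁(A, γ)`); the elementary
  `hasDerivAt_zero_of_isBigO_sq`/`not_isBigO_sq_of_hasDerivAt` (a function vanishing at `0` that is `O(λ²)` has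
  derivative `0` there); witness jets `wA` (`∂₁A₂ = t₁`, all else `0`), `wγ` (`∂₁γ = t₂`, `∂₂γ = t₃`), `c1_witness`
  (`c₁ = 4`), **`not_isBigO_defect1_witness`**: `Σ(F(wA))² − Σ(F(wA^{wγ}))²` is NOT `O(λ²)` — with `A^{γ,1}` in place
  of `A^{γ,2}` the printed sentence of p.353 would be false; (II.6)'s `(λ/2)[γ, ∂_μγ]` is exactly the term that makes
  it true. (In the `t`-expansion of (VIII.2), `A → A + tDγ`, there is no `t`-linear term — gen 5's
  `fieldStrengthSq_gaugeLine`; the two expansions, in `γ` and in `λ`, are different statements and both are now in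
  the tree.)
* §5 (v1.1) **THE EXPANSION IN `γ`.** `GaugeJet.smul` (`γ ↦ tγ`), `smul_symm`, `xTerm1`/`xTerm2`/`xTerm_smul` (`X(tγ) =
  tX¹ + t²X²`), `qqTerm`, **`curvature_gaugeTrunc2_smul`** (`F_μν(A^{tγ,2}) = F_μν(A) − tλ[F_μν(A), γ] + t²λ²·qq_μν(t)`: the
  `t¹` part of `Q(tγ)` vanishes by Jacobi), `pairTermT`, `sum_sq_curvature_gaugeTrunc2_smul`, `remT`,
  **`fieldStrengthSq_gaugeTrunc2_smul`** (`Σ(F(A^{tγ,2}))² = Σ(F(A))² + t²·R(t)`), **`defectM_smul_eq`** (`M(A, tγ) =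
  −t²R(t)`), `defectM_eq_neg_remT_one`, `continuous_remT`, `hasDerivAt_const_add_sq_mul_of_continuousAt`,
  **`hasDerivAt_defectM_smul`** (`d/dt|₀ M(A, tγ) = 0`): «no first order dependence in γ» (VIII.2) holds for the
  truncated transformation as well — the defect of (IV.2) is of second order BOTH in `λ` and in `γ`.

**Readings (declared).** (J) jets, as above: the position-space statement (IV.2) about `∫_Λ` of these densities for
the smooth cut-off sample fields (p.352 tl.26–27) follows by integrating the pointwise identities; no function space,
torus or measure is typed in this file (the integration of such jet identities over the flat torus is the business
of `…MRS93PositionSpaceFields` §11). (K) `γ ∈ C²` enters as the hypothesis `GaugeJet.Symm` (symmetric second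
derivatives) exactly where used. (N) normalisation: «F²», «F²_sp», «⟨A, p₀²A⟩» are read as the pointwise sums of
squares named above (coefficient questions between (II.2), (II.9)–(II.10) and (II.78) are recorded in
`…MRS93AxialYMAction`'s module docstring and do not affect a statement of the form «difference = λ²·polynomial»).
(T) the wedge-product sign is the print's (`TruncatedGauge.bracket`), as in every MRS file of the tree.

**Honest status / what is NOT claimed.** (IV.2) is a DISPLAY stating an algebraic fact, and that fact is what is
proved; its ROLE in the paper (which vertices of `M` are «dominable», Sect. IV pp.353–354; that `M` is «treated as an
interaction») is analytic and is neither typed nor asserted. The exact invariance under (II.4) quoted in the first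
sentence is the tree's `FiniteGauge.trace_curv_sq_gaugeAct` (`…MRS93FiniteGaugeTransformations`), not re-derived.
Nothing here instantiates MRS's measure (II.78)/(IV.1), nothing bears on Bałaban's papers, nothing is continuum YM₄ on
`T⁴` without infrared cutoff, nothing is Clay.
-/

noncomputable section

namespace Literature.MathematicalPhysics.QuantumFieldTheory.MagnenRivasseauSeneor1993

namespace TruncatedGaugeDefect

open SectIV TruncatedGauge InfinitesimalGauge AxialWard Filter Topology Asymptotics

/-! ## §1 The curvature of `A′ = A^{γ,2}` exactly: `F(A^{γ,2}) = F(A) − λ[F(A), γ] + λ²Q` -/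

/-- The `λ`-cofactor of (II.6) beyond the abelian shift: `X_ν := −[A_ν, γ] + ½[γ, ∂_νγ]`, so that
`A^{γ,2}_ν = A_ν + ∂_νγ + λX_ν` (`gaugeTrunc2_val_eq`). [cite: MagnenRivasseauSeneor1993, §II.A (II.6) p.329 tl.16–18] -/
def xTerm (A : FieldJet) (γ : GaugeJet) (ν : Fin 4) : Fin 3 → ℝ :=
  -bracket (A.val ν) γ.val + (1 / 2 : ℝ) • bracket γ.val (γ.der ν)

/-- (II.6) regrouped by powers of `λ`: `A^{γ,2}_ν = A_ν + ∂_νγ + λX_ν` (values).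
[cite: MagnenRivasseauSeneor1993, §II.A (II.5)–(II.6) p.329 tl.9–18] -/
theorem gaugeTrunc2_val_eq (lam : ℝ) (A : FieldJet) (γ : GaugeJet) (ν : Fin 4) :
    (gaugeTrunc2 lam A γ).val ν = A.val ν + γ.der ν + lam • xTerm A γ ν := by
  ext a
  simp only [gaugeTrunc2, covD, xTerm, Pi.add_apply, Pi.sub_apply, Pi.smul_apply, Pi.neg_apply, smul_eq_mul]
  ring

/-- The explicit `λ²`-cofactor of the curvature of `A^{γ,2}`:
`Q_μν := −[[A_μ, A_ν], γ] − [A_μ, X_ν] + [A_ν, X_μ] − [∂_μγ, X_ν] − [X_μ, ∂_νγ] − λ[X_μ, X_ν]` (a polynomial in `λ` and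
the jets). [cite: MagnenRivasseauSeneor1993, §II.A (II.1) p.328, (II.6) p.329; §IV (IV.2) p.353] -/
def qTerm (lam : ℝ) (A : FieldJet) (γ : GaugeJet) (μ ν : Fin 4) : Fin 3 → ℝ :=
  -bracket (bracket (A.val μ) (A.val ν)) γ.val
    - bracket (A.val μ) (xTerm A γ ν) + bracket (A.val ν) (xTerm A γ μ)
    - bracket (γ.der μ) (xTerm A γ ν) - bracket (xTerm A γ μ) (γ.der ν)
    - lam • bracket (xTerm A γ μ) (xTerm A γ ν)

/-- **THE CURVATURE OF THE TRUNCATED TRANSFORM, EXACTLY.** For `γ` with symmetric second derivatives and every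
`λ, μ, ν`: `F_μν(A^{γ,2}) = F_μν(A) − λ[F_μν(A), γ] + λ²Q_μν`. The order-`λ` change is the infinitesimal rotation
`−λ[F, γ]` ALONE: the curl `∂_μ((λ/2)[γ, ∂_νγ]) − ∂_ν((λ/2)[γ, ∂_μγ]) = λ[∂_μγ, ∂_νγ]` of (II.6)'s second-order term
cancels the order-`λ` part of `−λ[D_μγ, D_νγ]` (compare `InfinitesimalGauge.curvature_gaugeInf` for `A^γ = A^{γ,1}`).
[cite: MagnenRivasseauSeneor1993, §II.A (II.1) p.328, (II.4)–(II.6) p.329 tl.4–18; §IV (IV.2) p.353 tl.2–5] -/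
theorem curvature_gaugeTrunc2 (lam : ℝ) (A : FieldJet) {γ : GaugeJet} (hγ : γ.Symm) (μ ν : Fin 4) :
    curvature lam (gaugeTrunc2 lam A γ) μ ν =
      curvature lam A μ ν - lam • bracket (curvature lam A μ ν) γ.val + lam ^ 2 • qTerm lam A γ μ ν := by
  have hs : γ.der2 ν μ = γ.der2 μ ν := hγ ν μ
  ext a
  simp only [curvature, gaugeTrunc2, covD, covDDer, qTerm, xTerm, hs, Pi.add_apply, Pi.sub_apply, Pi.neg_apply,
    Pi.smul_apply, smul_eq_mul, bracket_apply, Fin.sum_univ_three]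
  fin_cases a <;> simp [eps] <;> ring

/-- At `λ = 0` (abelian theory, `A^{γ,2} = A + ∂γ`) the curvature is exactly invariant.
[cite: MagnenRivasseauSeneor1993, §II.A (II.5)–(II.6) p.329; §IV (IV.2) p.353] -/
theorem curvature_gaugeTrunc2_zero_coupling (A : FieldJet) {γ : GaugeJet} (hγ : γ.Symm) (μ ν : Fin 4) :
    curvature 0 (gaugeTrunc2 0 A γ) μ ν = curvature 0 A μ ν := by
  rw [curvature_gaugeTrunc2 0 A hγ]
  simp

/-! ## §2 (IV.2): `Σ(F(A))² = Σ(F(A′))² + M(A, γ)`, `M(A, γ) = λ²·M₂ = O(λ²)` -/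

/-- Expansion of a square in `ℝ³`: `Σ_a(u − sv + rw)_a² = Σu² − 2sΣuv + 2rΣuw + s²Σv² − 2srΣvw + r²Σw²`.
[cite: MagnenRivasseauSeneor1993, §II.A (II.3) p.329 tl.2–3] -/
theorem sum_sq_sub_add (u v w : Fin 3 → ℝ) (s r : ℝ) :
    ∑ a, (u - s • v + r • w) a ^ 2 =
      ∑ a, u a ^ 2 - 2 * s * ∑ a, u a * v a + 2 * r * ∑ a, u a * w a + s ^ 2 * ∑ a, v a ^ 2 -
        2 * s * r * ∑ a, v a * w a + r ^ 2 * ∑ a, w a ^ 2 := by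
  simp only [Fin.sum_univ_three, Pi.sub_apply, Pi.add_apply, Pi.smul_apply, smul_eq_mul]
  ring

/-- The increment of `Σ_a(F^a_μν)²` under `A → A^{γ,2}` for ONE pair `(μ, ν)`, divided by `λ²`:
`|[F_μν, γ]|² + 2F_μν·Q_μν − 2λ[F_μν, γ]·Q_μν + λ²|Q_μν|²`. [cite: MagnenRivasseauSeneor1993, §IV (IV.2) p.353] -/
def pairTerm (lam : ℝ) (A : FieldJet) (γ : GaugeJet) (μ ν : Fin 4) : ℝ :=
  ∑ a, bracket (curvature lam A μ ν) γ.val a ^ 2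
    + 2 * ∑ a, curvature lam A μ ν a * qTerm lam A γ μ ν a
    - 2 * lam * ∑ a, bracket (curvature lam A μ ν) γ.val a * qTerm lam A γ μ ν a
    + lam ^ 2 * ∑ a, qTerm lam A γ μ ν a ^ 2

/-- One pair of indices: `Σ_a(F^a_μν(A^{γ,2}))² = Σ_a(F^a_μν(A))² + λ²·pairTerm` — the `λ`-linear coefficient
`−2λΣ_a F^a_μν[F_μν, γ]^a` vanishes (`InfinitesimalGauge.dot_curvature_bracket_self`).
[cite: MagnenRivasseauSeneor1993, §II.A (II.3)–(II.6) p.329; §IV (IV.2) p.353 tl.2–5] -/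
theorem sum_sq_curvature_gaugeTrunc2 (lam : ℝ) (A : FieldJet) {γ : GaugeJet} (hγ : γ.Symm) (μ ν : Fin 4) :
    ∑ a, curvature lam (gaugeTrunc2 lam A γ) μ ν a ^ 2 =
      ∑ a, curvature lam A μ ν a ^ 2 + lam ^ 2 * pairTerm lam A γ μ ν := by
  rw [curvature_gaugeTrunc2 lam A hγ, sum_sq_sub_add, dot_curvature_bracket_self]
  unfold pairTerm
  ring

/-- `M₂(λ, A, γ) := −Σ_{μν} pairTerm` — the explicit polynomial with `M(A, γ) = λ²·M₂` (`defectM_eq`).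
[cite: MagnenRivasseauSeneor1993, §IV (IV.2) p.353 tl.4–5] -/
def M2 (lam : ℝ) (A : FieldJet) (γ : GaugeJet) : ℝ := -∑ μ, ∑ ν, pairTerm lam A γ μ ν

/-- **`M(A, γ)` of (IV.2)** as a pointwise density: `M(A, γ) := Σ_{μνa}(F^a_μν(A))² − Σ_{μνa}(F^a_μν(A^{γ,2}))²`, «the
difference» between the action density and its value on the truncated transform `A′ = A^{γ,2}` (in the `A`-variables,
as printed). [cite: MagnenRivasseauSeneor1993, §IV (IV.2) p.353 tl.2–5] -/
def defectM (lam : ℝ) (A : FieldJet) (γ : GaugeJet) : ℝ :=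
  fieldStrengthSq lam A - fieldStrengthSq lam (gaugeTrunc2 lam A γ)

/-- **The action density of the truncated transform:** `Σ(F(A^{γ,2}))² = Σ(F(A))² − λ²·M₂(λ, A, γ)` for `γ ∈ C²`.
[cite: MagnenRivasseauSeneor1993, §IV (IV.2) p.353 tl.2–5; §II.A (II.6) p.329] -/
theorem fieldStrengthSq_gaugeTrunc2 (lam : ℝ) (A : FieldJet) {γ : GaugeJet} (hγ : γ.Symm) :
    fieldStrengthSq lam (gaugeTrunc2 lam A γ) = fieldStrengthSq lam A - lam ^ 2 * M2 lam A γ := by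
  unfold fieldStrengthSq M2
  simp_rw [sum_sq_curvature_gaugeTrunc2 lam A hγ]
  simp only [Finset.sum_add_distrib, Finset.mul_sum, mul_neg, sub_neg_eq_add]

/-- **(IV.2), first equation:** `Σ(F(A))² = Σ(F(A′))² + M(A, γ)` with `A′ = A^{γ,2}` (by the definition of `M`).
[cite: MagnenRivasseauSeneor1993, §IV (IV.2) p.353 tl.4–5] -/
theorem eqIV2 (lam : ℝ) (A : FieldJet) (γ : GaugeJet) :
    fieldStrengthSq lam A = fieldStrengthSq lam (gaugeTrunc2 lam A γ) + defectM lam A γ := by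
  unfold defectM
  ring

/-- **(IV.2), «a complicated polynomial with at least two powers of λ»:** `M(A, γ) = λ²·M₂(λ, A, γ)` with `M₂` the
explicit polynomial `M2` in `λ` and the jets (for `γ ∈ C²`). [cite: MagnenRivasseauSeneor1993, §IV (IV.2) p.353 tl.2–5] -/
theorem defectM_eq (lam : ℝ) (A : FieldJet) {γ : GaugeJet} (hγ : γ.Symm) :
    defectM lam A γ = lam ^ 2 * M2 lam A γ := by
  rw [defectM, fieldStrengthSq_gaugeTrunc2 lam A hγ]
  ring

/-- In particular `M(A, γ) = 0` at `λ = 0`. [cite: MagnenRivasseauSeneor1993, §IV (IV.2) p.353] -/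
theorem defectM_zero_coupling (A : FieldJet) {γ : GaugeJet} (hγ : γ.Symm) : defectM 0 A γ = 0 := by
  rw [defectM_eq 0 A hγ]
  simp

/-- The cofactor `pairTerm` is a polynomial, hence continuous, in `λ` (fixed jets).
[cite: MagnenRivasseauSeneor1993, §IV (IV.2) p.353] -/
theorem continuous_pairTerm (A : FieldJet) (γ : GaugeJet) (μ ν : Fin 4) :
    Continuous fun lam => pairTerm lam A γ μ ν := by
  unfold pairTerm
  simp only [Fin.sum_univ_three, bracket_apply, qTerm, xTerm, curvature, Pi.add_apply, Pi.sub_apply, Pi.neg_apply,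
    Pi.smul_apply, smul_eq_mul]
  fun_prop

/-- `M₂` is continuous in `λ` (fixed jets). [cite: MagnenRivasseauSeneor1993, §IV (IV.2) p.353] -/
theorem continuous_M2 (A : FieldJet) (γ : GaugeJet) : Continuous fun lam => M2 lam A γ := by
  unfold M2
  exact (continuous_finsetSum _ fun μ _ => continuous_finsetSum _ fun ν _ => continuous_pairTerm A γ μ ν).neg

/-- **(IV.2), «M(A, γ) = O(λ²)»** literally (Landau symbol as `λ → 0`, fixed jets, `γ ∈ C²`):
`(λ ↦ M(A, γ)) =O[𝓝 0] (λ ↦ λ²)`. [cite: MagnenRivasseauSeneor1993, §IV (IV.2) p.353 tl.4–5; §II.A p.329 tl.15 «as λ → 0»] -/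
theorem defectM_isBigO (A : FieldJet) {γ : GaugeJet} (hγ : γ.Symm) :
    (fun lam => defectM lam A γ) =O[𝓝 0] fun lam => lam ^ 2 := by
  have h1 : (fun lam => M2 lam A γ) =O[𝓝 0] fun _ => (1 : ℝ) :=
    ((continuous_M2 A γ).tendsto 0).isBigO_one ℝ
  have h2 := (isBigO_refl (fun lam : ℝ => lam ^ 2) (𝓝 0)).mul h1
  simp only [mul_one] at h2
  refine h2.congr' (Eventually.of_forall fun lam => ?_) EventuallyEq.rfl
  exact (defectM_eq lam A hγ).symm

/-! ## §3 The printed left side (axial `A`) and the decomposed field `A = A_s + B_l` -/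

/-- **p.342 tl.5 «A′₀ = ∂₀^{γ,2} = ∂₀γ + (λ/2)[γ, ∂₀γ]»** on jets: for an axial jet (`A₀ = 0`) the time component of
`A^{γ,2}` is `∂₀γ + (λ/2)[γ, ∂₀γ]`. [cite: MagnenRivasseauSeneor1993, §II.E p.342 tl.5–7; §II.A (II.6) p.329] -/
theorem gaugeTrunc2_val_time (lam : ℝ) {A : FieldJet} (hA : IsAxialJet A) (γ : GaugeJet) :
    (gaugeTrunc2 lam A γ).val 0 = γ.der 0 + (lam / 2) • bracket γ.val (γ.der 0) := by
  ext a
  simp [gaugeTrunc2, covD, hA.1, bracket_apply]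

/-- **(IV.2) WITH ITS PRINTED LEFT SIDE:** for an axial jet `A` (`A₀ = 0 = ∂_νA₀`), `S₀(A) = Σ(F(A^{γ,2}))² + M(A, γ)`,
where `S₀ = 2Σ_m|∂₀A_m|² + Σ_{mn a}(F^a_mn)²` is the density of «⟨A, p₀²A⟩ + F²_sp» — the split (II.9) at the point
(`AxialWard.fieldStrengthSq_eq_S0`). [cite: MagnenRivasseauSeneor1993, §IV (IV.2) p.353 tl.5; §II.A (II.9)–(II.10) p.330 tl.6–10] -/
theorem eqIV2_axial (lam : ℝ) {A : FieldJet} (hA : IsAxialJet A) (γ : GaugeJet) :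
    S0 lam A = fieldStrengthSq lam (gaugeTrunc2 lam A γ) + defectM lam A γ := by
  rw [← fieldStrengthSq_eq_S0 lam hA]
  exact eqIV2 lam A γ

/-- (II.32b) at `n = 2`, recalled BY NAME (`InfinitesimalGauge.gaugeTrunc2_add`): `(A_s + B_l)^{γ,2} = A_s^{γ,2} +
B_l^{rot γ,2}` — the pair `(A′_s, B′_l)` of Sect. II.C/(IV.4). [cite: MagnenRivasseauSeneor1993, §II.C (II.32b)–(II.32c) p.338 tl.42–46, p.339 tl.2–3; §IV (IV.4) p.354] -/
theorem gaugeTrunc2_sum (lam : ℝ) (A B : FieldJet) (γ : GaugeJet) :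
    gaugeTrunc2 lam (A.add B) γ = (gaugeTrunc2 lam A γ).add (rotTrunc lam B γ) :=
  gaugeTrunc2_add lam A B γ

/-- **(IV.2) for the decomposed field** `A = A_s + B_l`, `A′ = A′_s + B′_l = A_s^{γ,2} + B_l^{rot γ,2}`:
`Σ(F(A_s + B_l))² = Σ(F(A_s^{γ,2} + B_l^{rot γ,2}))² + M(A_s + B_l, γ)`.
[cite: MagnenRivasseauSeneor1993, §IV (IV.2) p.353, (IV.4) p.354; §II.C (II.32b) p.338] -/
theorem eqIV2_add (lam : ℝ) (A B : FieldJet) (γ : GaugeJet) :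
    fieldStrengthSq lam (A.add B) =
      fieldStrengthSq lam ((gaugeTrunc2 lam A γ).add (rotTrunc lam B γ)) + defectM lam (A.add B) γ := by
  rw [← gaugeTrunc2_sum]
  exact eqIV2 lam (A.add B) γ

/-! ## §4 Contrast: the first-order transformation `A^γ = A^{γ,1}` of (II.5) leaves ONE power of `λ` -/

/-- The difference for the FIRST-order transformation (II.5): `defect1 := Σ(F(A))² − Σ(F(A^γ))²`, `A^γ = A + Dγ`.
[cite: MagnenRivasseauSeneor1993, §II.A (II.5) p.329 tl.9–11; §IV (IV.2) p.353] -/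
def defect1 (lam : ℝ) (A : FieldJet) (γ : GaugeJet) : ℝ :=
  fieldStrengthSq lam A - fieldStrengthSq lam (gaugeInf lam A γ)

/-- The `λ`-cofactor of `defect1`: `g₁(λ) := Σ_{μν}(2F_μν·[D_μγ, D_νγ] − λ(|[F_μν, γ]|² + 2[F_μν, γ]·[D_μγ, D_νγ] +
|[D_μγ, D_νγ]|²))` (from `InfinitesimalGauge.gaugeRemainder` at `t = 1`).
[cite: MagnenRivasseauSeneor1993, §II.A (II.5) p.329; §IV (IV.2) p.353] -/
def g1 (lam : ℝ) (A : FieldJet) (γ : GaugeJet) : ℝ :=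
  ∑ μ, ∑ ν, (2 * ∑ a, curvature lam A μ ν a * bracket (covD lam A γ μ) (covD lam A γ ν) a
    - lam * (∑ a, bracket (curvature lam A μ ν) γ.val a ^ 2
      + 2 * ∑ a, bracket (curvature lam A μ ν) γ.val a * bracket (covD lam A γ μ) (covD lam A γ ν) a
      + ∑ a, bracket (covD lam A γ μ) (covD lam A γ ν) a ^ 2))

/-- `defect1 = λ·g₁(λ)` for `γ ∈ C²` — ONE explicit power of `λ` (by gen 5's `fieldStrengthSq_gaugeInf`:
`Σ(F(A^γ))² = Σ(F(A))² + R(1)`). [cite: MagnenRivasseauSeneor1993, §II.A (II.5) p.329; §IV (IV.2) p.353] -/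
theorem defect1_eq (lam : ℝ) (A : FieldJet) {γ : GaugeJet} (hγ : γ.Symm) :
    defect1 lam A γ = lam * g1 lam A γ := by
  rw [defect1, fieldStrengthSq_gaugeInf lam A hγ]
  unfold gaugeRemainder g1 remC0 remC1 remC2
  simp only [one_mul, one_pow, Finset.mul_sum, ← Finset.sum_add_distrib, ← Finset.sum_sub_distrib]
  have : ∀ x y : ℝ, x - (x + y) = -y := fun x y => by ring
  rw [this, ← Finset.sum_neg_distrib]
  refine Finset.sum_congr rfl fun μ _ => ?_
  rw [← Finset.sum_neg_distrib]
  refine Finset.sum_congr rfl fun ν _ => ?_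
  rw [← Finset.sum_neg_distrib]
  refine Finset.sum_congr rfl fun a _ => ?_
  ring

/-- The order-`λ` coefficient of `defect1`: `c₁(A, γ) := 2Σ_{μνa}(∂_μA_ν − ∂_νA_μ)^a [∂_μγ, ∂_νγ]^a` (the abelian
curvature paired with the commutator of the gradients of `γ`). [cite: MagnenRivasseauSeneor1993, §II.A (II.1) p.328, (II.5) p.329; §IV (IV.2) p.353] -/
def c1 (A : FieldJet) (γ : GaugeJet) : ℝ :=
  2 * ∑ μ, ∑ ν, ∑ a, (A.der μ ν - A.der ν μ) a * bracket (γ.der μ) (γ.der ν) a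

/-- `g₁(0) = c₁`. [cite: MagnenRivasseauSeneor1993, §II.A (II.5) p.329; §IV (IV.2) p.353] -/
theorem g1_zero (A : FieldJet) (γ : GaugeJet) : g1 0 A γ = c1 A γ := by
  simp only [g1, c1, curvature, covD, zero_smul, sub_zero, zero_mul, Finset.mul_sum]

/-- `g₁` is continuous in `λ` (a polynomial). [cite: MagnenRivasseauSeneor1993, §II.A (II.5) p.329; §IV (IV.2) p.353] -/
theorem continuous_g1 (A : FieldJet) (γ : GaugeJet) : Continuous fun lam => g1 lam A γ := by
  unfold g1
  refine continuous_finsetSum _ fun μ _ => continuous_finsetSum _ fun ν _ => ?_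
  simp only [Fin.sum_univ_three, bracket_apply, curvature, covD, Pi.sub_apply, Pi.smul_apply, smul_eq_mul]
  fun_prop

/-- **`d/dλ|_{λ=0}(Σ(F(A))² − Σ(F(A^γ))²) = c₁(A, γ)`** for `γ ∈ C²`: the first-order transformation (II.5) changes the
action density at order `λ¹` with coefficient `c₁`. [cite: MagnenRivasseauSeneor1993, §II.A (II.5)–(II.6) p.329 tl.9–18; §IV (IV.2) p.353] -/
theorem hasDerivAt_defect1 (A : FieldJet) {γ : GaugeJet} (hγ : γ.Symm) :
    HasDerivAt (fun lam => defect1 lam A γ) (c1 A γ) 0 := by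
  have hg : Tendsto (fun lam => g1 lam A γ) (𝓝 0) (𝓝 (c1 A γ)) := by
    rw [← g1_zero]
    exact (continuous_g1 A γ).tendsto 0
  rw [hasDerivAt_iff_isLittleO]
  have h0 : defect1 0 A γ = 0 := by rw [defect1_eq 0 A hγ]; simp
  simp only [h0, sub_zero, smul_eq_mul]
  have h1 : (fun lam => g1 lam A γ - c1 A γ) =o[𝓝 0] fun _ => (1 : ℝ) := by
    rw [isLittleO_one_iff]
    simpa using hg.sub_const (c1 A γ)
  have h2 := (isBigO_refl (fun lam : ℝ => lam) (𝓝 0)).mul_isLittleO h1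
  simp only [mul_one] at h2
  refine h2.congr' (Eventually.of_forall fun lam => ?_) EventuallyEq.rfl
  show lam * (g1 lam A γ - c1 A γ) = defect1 lam A γ - lam * c1 A γ
  rw [defect1_eq lam A hγ]
  ring

/-- Calculus: a real function with `f(0) = 0` and `f = O(λ²)` as `λ → 0` has derivative `0` at `0`.
[cite: MagnenRivasseauSeneor1993, §IV (IV.2) p.353 tl.4–5] -/
theorem hasDerivAt_zero_of_isBigO_sq {f : ℝ → ℝ} (h0 : f 0 = 0) (h : f =O[𝓝 0] fun lam => lam ^ 2) :
    HasDerivAt f 0 0 := by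
  rw [hasDerivAt_iff_isLittleO]
  simp only [h0, sub_zero, smul_zero]
  have h2 : (fun lam : ℝ => lam ^ 2) =o[𝓝 0] fun lam => lam := by
    simpa using isLittleO_pow_id (one_lt_two)
  exact h.trans_isLittleO h2

/-- Hence a function with `f(0) = 0` and a NON-ZERO derivative at `0` is not `O(λ²)`.
[cite: MagnenRivasseauSeneor1993, §IV (IV.2) p.353 tl.4–5] -/
theorem not_isBigO_sq_of_hasDerivAt {f : ℝ → ℝ} {c : ℝ} (h0 : f 0 = 0) (hf : HasDerivAt f c 0) (hc : c ≠ 0) :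
    ¬ f =O[𝓝 0] fun lam => lam ^ 2 := fun h =>
  hc (hf.unique (hasDerivAt_zero_of_isBigO_sq h0 h))

/-- Witness field jet: `∂₁A₂ = t₁` (colour `1`), every other value and derivative `0` (so `F⁰₁₂ = t₁ = −F⁰₂₁`).
[cite: MagnenRivasseauSeneor1993, §II.A (II.1) p.328; §IV (IV.2) p.353] -/
def wA : FieldJet where
  val := 0
  der μ ν := if μ = 1 ∧ ν = 2 then Pi.single 0 1 else 0

/-- Witness gauge jet: `γ = 0`, `∂₁γ = t₂`, `∂₂γ = t₃` (so `[∂₁γ, ∂₂γ] = t₁`), second derivatives `0`.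
[cite: MagnenRivasseauSeneor1993, §II.A (II.5) p.329; §IV (IV.2) p.353] -/
def wγ : GaugeJet where
  val := 0
  der μ := if μ = 1 then Pi.single 1 1 else if μ = 2 then Pi.single 2 1 else 0
  der2 := 0

/-- The witness `γ` has symmetric (zero) second derivatives. [cite: MagnenRivasseauSeneor1993, §II.A (II.5) p.329] -/
theorem wγ_symm : wγ.Symm := fun _ _ => rfl

/-- On the witness jets `c₁ = 4 ≠ 0` (the pairs `(1,2)` and `(2,1)` contribute `1` each, doubled).
[cite: MagnenRivasseauSeneor1993, §II.A (II.5) p.329; §IV (IV.2) p.353] -/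
theorem c1_witness : c1 wA wγ = 4 := by
  simp [c1, Fin.sum_univ_four, Fin.sum_univ_three, bracket_apply, eps, wA, wγ]
  norm_num

/-- **WITH `A^{γ,1}` IN PLACE OF `A^{γ,2}` THE SENTENCE OF p.353 WOULD BE FALSE:** on the witness jets the difference
`Σ(F(A))² − Σ(F(A^γ))²` for the first-order transformation (II.5) is NOT `O(λ²)` as `λ → 0` (its derivative at `λ =
0` is `c₁ = 4`). The second-order term `(λ/2)[γ, ∂_μγ]` of (II.6) is exactly what restores «at least two powers of λ»
(`defectM_eq`). [cite: MagnenRivasseauSeneor1993, §II.A (II.5)–(II.6) p.329 tl.9–18 «we want to keep all terms not small as λ → 0»; §IV (IV.2) p.353 tl.2–5] -/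
theorem not_isBigO_defect1_witness : ¬ (fun lam => defect1 lam wA wγ) =O[𝓝 0] fun lam => lam ^ 2 := by
  refine not_isBigO_sq_of_hasDerivAt ?_ (hasDerivAt_defect1 wA wγ_symm) ?_
  · rw [defect1_eq 0 wA wγ_symm]
    simp
  · rw [c1_witness]
    norm_num

/-! ## §5 (v1.1) The expansion in `γ`: `M(A, tγ)` has NO term linear in `t` either — (IV.2) against (VIII.2) -/

/-- Scalar multiple of a gauge jet, `γ ↦ tγ` (values, first and second derivatives scale) — the line along which
(VIII.2) expands («no first order dependence in γ», p.377 tl.22–23).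
[cite: MagnenRivasseauSeneor1993, §II.A (II.5)–(II.6) p.329; §VIII (VIII.2) p.377 tl.22–23] -/
def _root_.Literature.MathematicalPhysics.QuantumFieldTheory.MagnenRivasseauSeneor1993.InfinitesimalGauge.GaugeJet.smul
    (t : ℝ) (γ : GaugeJet) : GaugeJet where
  val := t • γ.val
  der μ := t • γ.der μ
  der2 μ ν := t • γ.der2 μ ν

/-- Scaling preserves the Schwarz symmetry of the second derivatives.
[cite: MagnenRivasseauSeneor1993, §II.A (II.5) p.329] -/
theorem smul_symm {γ : GaugeJet} (hγ : γ.Symm) (t : ℝ) : (GaugeJet.smul t γ).Symm := fun μ ν => by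
  show t • γ.der2 μ ν = t • γ.der2 ν μ
  rw [hγ μ ν]

/-- The part of `X_ν` linear in `γ`: `−[A_ν, γ]`. [cite: MagnenRivasseauSeneor1993, §II.A (II.5)–(II.6) p.329] -/
def xTerm1 (A : FieldJet) (γ : GaugeJet) (ν : Fin 4) : Fin 3 → ℝ := -bracket (A.val ν) γ.val

/-- The part of `X_ν` quadratic in `γ`: `½[γ, ∂_νγ]` (the second-order term of (II.6) over `λ`).
[cite: MagnenRivasseauSeneor1993, §II.A (II.6) p.329 tl.16–18] -/
def xTerm2 (γ : GaugeJet) (ν : Fin 4) : Fin 3 → ℝ := (1 / 2 : ℝ) • bracket γ.val (γ.der ν)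

/-- `X_ν(tγ) = tX¹_ν + t²X²_ν`. [cite: MagnenRivasseauSeneor1993, §II.A (II.6) p.329] -/
theorem xTerm_smul (A : FieldJet) (γ : GaugeJet) (t : ℝ) (ν : Fin 4) :
    xTerm A (GaugeJet.smul t γ) ν = t • xTerm1 A γ ν + t ^ 2 • xTerm2 γ ν := by
  ext a
  simp only [xTerm, xTerm1, xTerm2, GaugeJet.smul, Pi.add_apply, Pi.neg_apply, Pi.smul_apply, smul_eq_mul,
    bracket_apply, Fin.sum_univ_three]
  ring

/-- The `t²λ²`-cofactor of the curvature of `A^{tγ,2}`, an explicit polynomial in `t` (degrees `0, 1, 2`): the `t¹`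
part of `Q(tγ)`, `−[[A_μ, A_ν], γ] − [A_μ, X¹_ν] + [A_ν, X¹_μ]`, VANISHES by the Jacobi identity, so `Q(tγ) = t²·qq(t)`.
[cite: MagnenRivasseauSeneor1993, §II.A (II.1) p.328, (II.6) p.329; §IV (IV.2) p.353; §VIII (VIII.2) p.377] -/
def qqTerm (lam : ℝ) (A : FieldJet) (γ : GaugeJet) (t : ℝ) (μ ν : Fin 4) : Fin 3 → ℝ :=
  (-bracket (A.val μ) (xTerm2 γ ν) + bracket (A.val ν) (xTerm2 γ μ)
    - bracket (γ.der μ) (xTerm1 A γ ν) - bracket (xTerm1 A γ μ) (γ.der ν)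
    - lam • bracket (xTerm1 A γ μ) (xTerm1 A γ ν))
  + t • (-bracket (γ.der μ) (xTerm2 γ ν) - bracket (xTerm2 γ μ) (γ.der ν)
    - lam • (bracket (xTerm1 A γ μ) (xTerm2 γ ν) + bracket (xTerm2 γ μ) (xTerm1 A γ ν)))
  + t ^ 2 • (-lam • bracket (xTerm2 γ μ) (xTerm2 γ ν))

/-- **THE CURVATURE OF `A^{tγ,2}` ALONG THE LINE IN `γ`:** `F_μν(A^{tγ,2}) = F_μν(A) − tλ[F_μν(A), γ] + t²λ²·qq_μν(t)` for
`γ ∈ C²` and every `t, λ` — the `t`-linear change is the infinitesimal rotation ALONE (as for `A + tDγ`,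
`InfinitesimalGauge.curvature_gaugeLine`), the second-order term `(λ/2)[tγ, t∂γ]` of (II.6) entering at `t²`.
[cite: MagnenRivasseauSeneor1993, §II.A (II.5)–(II.6) p.329; §IV (IV.2) p.353; §VIII (VIII.2) p.377 tl.22–23] -/
theorem curvature_gaugeTrunc2_smul (lam : ℝ) (A : FieldJet) {γ : GaugeJet} (hγ : γ.Symm) (t : ℝ) (μ ν : Fin 4) :
    curvature lam (gaugeTrunc2 lam A (GaugeJet.smul t γ)) μ ν =
      curvature lam A μ ν - (t * lam) • bracket (curvature lam A μ ν) γ.val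
        + (t ^ 2 * lam ^ 2) • qqTerm lam A γ t μ ν := by
  have hs : γ.der2 ν μ = γ.der2 μ ν := hγ ν μ
  ext a
  simp only [curvature, gaugeTrunc2, GaugeJet.smul, covD, covDDer, qqTerm, xTerm1, xTerm2, hs, Pi.add_apply,
    Pi.sub_apply, Pi.neg_apply, Pi.smul_apply, smul_eq_mul, bracket_apply, Fin.sum_univ_three]
  fin_cases a <;> simp [eps] <;> ring

/-- The per-pair `t²`-cofactor of `Σ_a(F^a_μν(A^{tγ,2}))² − Σ_a(F^a_μν(A))²`:
`λ²|[F_μν, γ]|² + 2λ²F_μν·qq_μν(t) − 2tλ³[F_μν, γ]·qq_μν(t) + t²λ⁴|qq_μν(t)|²`.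
[cite: MagnenRivasseauSeneor1993, §IV (IV.2) p.353; §VIII (VIII.2) p.377] -/
def pairTermT (lam : ℝ) (A : FieldJet) (γ : GaugeJet) (t : ℝ) (μ ν : Fin 4) : ℝ :=
  lam ^ 2 * ∑ a, bracket (curvature lam A μ ν) γ.val a ^ 2
    + 2 * lam ^ 2 * ∑ a, curvature lam A μ ν a * qqTerm lam A γ t μ ν a
    - 2 * t * lam ^ 3 * ∑ a, bracket (curvature lam A μ ν) γ.val a * qqTerm lam A γ t μ ν a
    + t ^ 2 * lam ^ 4 * ∑ a, qqTerm lam A γ t μ ν a ^ 2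

/-- One pair: `Σ_a(F^a_μν(A^{tγ,2}))² = Σ_a(F^a_μν(A))² + t²·pairTermT(t)` — NO `t`-linear term
(`Σ_a F^a[F, γ]^a = 0`). [cite: MagnenRivasseauSeneor1993, §IV (IV.2) p.353; §VIII (VIII.2) p.377 tl.22–23] -/
theorem sum_sq_curvature_gaugeTrunc2_smul (lam : ℝ) (A : FieldJet) {γ : GaugeJet} (hγ : γ.Symm) (t : ℝ)
    (μ ν : Fin 4) :
    ∑ a, curvature lam (gaugeTrunc2 lam A (GaugeJet.smul t γ)) μ ν a ^ 2 =
      ∑ a, curvature lam A μ ν a ^ 2 + t ^ 2 * pairTermT lam A γ t μ ν := by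
  rw [curvature_gaugeTrunc2_smul lam A hγ t, sum_sq_sub_add, dot_curvature_bracket_self]
  unfold pairTermT
  ring

/-- The `t²`-cofactor of the action density of `A^{tγ,2}`, `R(t) := Σ_{μν} pairTermT(t)`.
[cite: MagnenRivasseauSeneor1993, §IV (IV.2) p.353; §VIII (VIII.2) p.377] -/
def remT (lam : ℝ) (A : FieldJet) (γ : GaugeJet) (t : ℝ) : ℝ := ∑ μ, ∑ ν, pairTermT lam A γ t μ ν

/-- **`Σ(F(A^{tγ,2}))² = Σ(F(A))² + t²·R(t)`** for `γ ∈ C²`: the truncated transformation, like the first-order one of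
(VIII.2) (`InfinitesimalGauge.fieldStrengthSq_gaugeLine`), changes the action density only at SECOND order in `γ`.
[cite: MagnenRivasseauSeneor1993, §IV (IV.2) p.353 tl.2–5; §VIII (VIII.2) p.377 tl.22–23] -/
theorem fieldStrengthSq_gaugeTrunc2_smul (lam : ℝ) (A : FieldJet) {γ : GaugeJet} (hγ : γ.Symm) (t : ℝ) :
    fieldStrengthSq lam (gaugeTrunc2 lam A (GaugeJet.smul t γ)) = fieldStrengthSq lam A + t ^ 2 * remT lam A γ t := by
  unfold fieldStrengthSq remT
  simp_rw [sum_sq_curvature_gaugeTrunc2_smul lam A hγ t]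
  simp only [Finset.sum_add_distrib, Finset.mul_sum]

/-- Hence **`M(A, tγ) = −t²·R(t)`**: the defect of (IV.2) has no term linear in `γ`.
[cite: MagnenRivasseauSeneor1993, §IV (IV.2) p.353; §VIII (VIII.2) p.377 tl.22–23] -/
theorem defectM_smul_eq (lam : ℝ) (A : FieldJet) {γ : GaugeJet} (hγ : γ.Symm) (t : ℝ) :
    defectM lam A (GaugeJet.smul t γ) = -(t ^ 2 * remT lam A γ t) := by
  rw [defectM, fieldStrengthSq_gaugeTrunc2_smul lam A hγ t]
  ring

/-- At `t = 1` the scaled jet is `γ` itself, so `M(A, γ) = −R(1)`: a second expression for the defect, organised by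
the order in `γ` instead of the order in `λ` (`defectM_eq`). [cite: MagnenRivasseauSeneor1993, §IV (IV.2) p.353] -/
theorem defectM_eq_neg_remT_one (lam : ℝ) (A : FieldJet) {γ : GaugeJet} (hγ : γ.Symm) :
    defectM lam A γ = -remT lam A γ 1 := by
  have h := defectM_smul_eq lam A hγ 1
  have h1 : GaugeJet.smul 1 γ = γ := by
    cases γ
    simp [GaugeJet.smul]
  rw [h1] at h
  simpa using h

/-- `R(t)` is continuous in `t` (a polynomial). [cite: MagnenRivasseauSeneor1993, §IV (IV.2) p.353] -/
theorem continuous_remT (lam : ℝ) (A : FieldJet) (γ : GaugeJet) : Continuous fun t => remT lam A γ t := by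
  unfold remT
  refine continuous_finsetSum _ fun μ _ => continuous_finsetSum _ fun ν _ => ?_
  unfold pairTermT
  simp only [Fin.sum_univ_three, bracket_apply, qqTerm, xTerm1, xTerm2, curvature, Pi.add_apply, Pi.sub_apply,
    Pi.neg_apply, Pi.smul_apply, smul_eq_mul]
  fun_prop

/-- Calculus: `t ↦ S + t²g(t)` with `g` continuous at `0` has derivative `0` at `t = 0`.
[cite: MagnenRivasseauSeneor1993, §VIII (VIII.2) p.377 tl.22–23] -/
theorem hasDerivAt_const_add_sq_mul_of_continuousAt {g : ℝ → ℝ} (hg : ContinuousAt g 0) (S : ℝ) :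
    HasDerivAt (fun t => S + t ^ 2 * g t) 0 0 := by
  rw [hasDerivAt_iff_isLittleO]
  simp only [zero_pow two_ne_zero, zero_mul, add_zero, sub_zero, smul_zero, add_sub_cancel_left]
  have h1 : (fun t : ℝ => t * g t) =o[𝓝 0] fun _ => (1 : ℝ) := by
    rw [isLittleO_one_iff]
    simpa using ((continuous_id.tendsto (0 : ℝ)).mul hg.tendsto)
  have h2 := (isBigO_refl (fun t : ℝ => t) (𝓝 0)).mul_isLittleO h1
  simp only [mul_one] at h2
  refine h2.congr' (Eventually.of_forall fun t => ?_) EventuallyEq.rfl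
  show t * (t * g t) = t ^ 2 * g t
  ring

/-- **«NO FIRST ORDER DEPENDENCE IN γ» FOR THE TRUNCATED TRANSFORMATION TOO:** `d/dt|_{t=0} M(A, tγ) = 0` for `γ ∈ C²` —
the defect of (IV.2) starts at second order in `γ` as well as at second order in `λ` (`defectM_eq`); the two printed
statements, (IV.2) «at least two powers of λ» and (VIII.2) «no first order dependence in γ», are thereby both theorems
about the same polynomial `M(A, γ)`. [cite: MagnenRivasseauSeneor1993, §IV (IV.2) p.353 tl.2–5; §VIII (VIII.2) p.377 tl.22–23] -/
theorem hasDerivAt_defectM_smul (lam : ℝ) (A : FieldJet) {γ : GaugeJet} (hγ : γ.Symm) :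
    HasDerivAt (fun t => defectM lam A (GaugeJet.smul t γ)) 0 0 := by
  have hg : ContinuousAt (fun t => -remT lam A γ t) 0 := ((continuous_remT lam A γ).neg).continuousAt
  have h := hasDerivAt_const_add_sq_mul_of_continuousAt hg 0
  refine h.congr_of_eventuallyEq (Eventually.of_forall fun t => ?_)
  show defectM lam A (GaugeJet.smul t γ) = 0 + t ^ 2 * -remT lam A γ t
  rw [defectM_smul_eq lam A hγ t]
  ring

end TruncatedGaugeDefect

end Literature.MathematicalPhysics.QuantumFieldTheory.MagnenRivasseauSeneor1993
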